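import Literature.Probability.Percolation.ParaPivotalSumBounds
import HarnessLib

/-!
# `θ(p) ≍ π₁(L_ε(p))` for every `ε`: reductions of `Nolin2008_theta_asymp` (proofs only)

Topic `Literature/Probability/Percolation`; family `crit-perc`. Proofs only (no new definition, no
new named fact) towards the discharge of the named fact `Nolin2008_theta_asymp` of
`KestenScaling.lean` (P. Nolin, *Near-critical percolation in two dimensions*, Electron. J. Probab.
13 (2008), §7.4, Cor. 41 with eq. (7.25) [arXiv 0711.4948: Cor. 39]: for `p > 1/2`,
`θ(p) ≍ P_p(0 ⇝ ∂S_{L(p)}) ≍ P_{1/2}(0 ⇝ ∂S_{L(p)}) = π₁(L(p))`, for every fixed `ε ∈ (0, 1/2)`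
(§7.1: "All the results we have seen so far hold for any fixed value of `ε` in `(0, 1/2)`")).

## What is proved here

Write `U(ε)` for the upper half `θ(p) ≤ C π₁(L_ε(p))` and `Λ(ε)` for the lower half
`c π₁(L_ε(p)) ≤ θ(p)` (`p` in a right neighbourhood of `1/2`). Since `L_ε(p)` is non-increasing in
`ε` (`charLength_anti`, `KestenRelationRussoProofs.lean`) and `π₁(N) = P_{1/2}(0 ↔ ∂Λ_N)` is
non-increasing in `N` (`triOneArm_anti`), the quantity `π₁(L_ε(p))` is non-decreasing in `ε`.
Consequently:

* `U(ε₀) ⇒ U(ε)` for `ε ≥ ε₀`: the upper half needs the near-critical stability of the one-arm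
  probability at SMALL `ε` only. The tree's `Werner2009_oneArm_nearCritical`
  (`WernerCorrelationLength.lean`: Werner 2009, Lecture 6, §5, for every `ε` below a threshold and
  Werner's length `L(p, ε) ≥ L_ε(p)`, `charLength_le_charLengthW`) therefore gives `U(ε)` for EVERY
  `ε > 0` (`triTheta_le_of_oneArm_nearCritical`), and `Nolin2008_theta_asymp` follows from it and
  `Nolin2008_cor41` (`Nolin2008_theta_asymp_of_oneArm_nearCritical`). Compared with the tree's
  `Nolin2008_theta_asymp_of_nearCritical` (`NearCriticalScaling.lean`), this replaces the leaf
  `Nolin2008_thm27_oneArm` (two-sided, both sides of `1/2`, every `ε`, Nolin's length — reduced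
  nowhere in the tree) by `Werner2009_oneArm_nearCritical`, which the tree reduces to five standard
  near-critical arm estimates (`Werner2009_oneArm_nearCritical_of_facts`,
  `ParaPivotalSumBounds.lean`); whence `Nolin2008_theta_asymp_of_facts` and, through the ladder
  `Nolin2008_cor41_of_ladder` (`NearCriticalArm.lean`) with `tri_rsw_half_holds` and
  `Nolin2008_subcritical_crossing_holds`, `Nolin2008_theta_asymp_of_facts'` (five arm estimates +
  the uniform exponential decay `Nolin2008_lemma39`).
* `Λ(ε') ⇒ Λ(ε)` for `ε ≤ ε'` (`le_triTheta_anti`): the lower half is needed for `ε'` arbitrarily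
  close to `1/2` (where `L_{ε'}(p)` is a small scale). Via Cor. 41 this is the uniform exponential
  decay (Lemma 39) at such `ε'`, which Nolin obtains only through the equivalence of lengths
  `L_ε ≍ L_{ε'}` (Cor. 37 [arXiv: Cor. 35], from Kesten's relation Prop. 34 at `ε'` and the
  four-arm estimates; Nolin, after Lemma 39: by RSW alone "only for `ε, ε'` less than some fixed
  value"). This is the remaining crux of the all-`ε` statement; it is NOT proved here.

## References

* P. Nolin, Near-critical percolation in two dimensions, *Electron. J. Probab.* 13 (2008), §7.1,
  §7.3 Cor. 37, §7.4 Lemma 39, Cor. 41, eq. (7.25) (arXiv 0711.4948: Cor. 35, Lemma 37, Cor. 39)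
  [Nolin2008].
* W. Werner, *Lectures on two-dimensional critical percolation*, PCMI (2009), Lecture 6, §1 and §5
  [WernerPCMI2009].

Tree: `charLength`, `charLength_symm`, `triLRCrossingProb_charLength_le`, `Nolin2008_theta_asymp`
(`KestenScaling.lean`); `charLength_set_nonempty` (`KestenRelationRusso.lean`); `charLength_anti`
(`KestenRelationRussoProofs.lean`, of which a private copy is used here);
`Nolin2008_subcritical_crossing_holds`, `one_le_charLength` (`NearCriticalRSW.lean`);
`triTheta_le_real_triOneArm`, `critOneArmProb_le_real_triOneArm`, `Nolin2008_cor41`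
(`NearCriticalScaling.lean`); `triOneArm_anti` (`NearCriticalCorrelationLength.lean`);
`charLength_le_charLengthW` (`WernerCorrelationLengthProofs.lean`); `Werner2009_oneArm_nearCritical`
(`WernerCorrelationLength.lean`); `Werner2009_oneArm_nearCritical_of_facts`
(`ParaPivotalSumBounds.lean`); `Nolin2008_cor41_of_ladder`, `Nolin2008_lemma39` (`NearCriticalArm.lean`);
`tri_rsw_half_holds` (`TriThetaHalf.lean`). Mathlib: real arithmetic only; no percolation.
-/

noncomputable section

open Filter Topology MeasureTheory Set
open scoped unitInterval

namespace Literature.Probability.Percolation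

open LatticeModels

/-! ### Monotonicity of `L_ε(p)` in `ε` (local copy) -/

/-- `L_ε(p)` is non-increasing in `ε`: for `0 < ε ≤ ε'` and `p ≠ 1/2`, `L_{ε'}(p) ≤ L_ε(p)` (Nolin
2008, §7.3, proof of Cor. 37 [arXiv 0711.4948: Cor. 35]: "assume that `ε ≤ ε'`, so that
`L_ε(p) ≥ L_{ε'}(p)`"). A private copy, for this file, of the tree's `charLength_anti`
(`KestenRelationRussoProofs.lean`), specialised to `Nolin2008_subcritical_crossing_holds`. [cite: Nolin2008, §7.3, proof of Cor. 37 (arXiv 0711.4948: Cor. 35)] -/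
private theorem charLength_anti_aux {ε ε' : ℝ} (hε : 0 < ε) (hεε' : ε ≤ ε') {p : unitInterval}
    (hp : (p : ℝ) ≠ 1 / 2) : charLength ε' p ≤ charLength ε p := by
  -- below `1/2`
  have key : ∀ q : unitInterval, (q : ℝ) < 1 / 2 → charLength ε' q ≤ charLength ε q := by
    intro q hq
    have hmem : triLRCrossingProb (min q (σ q)) (charLength ε q) (charLength ε q) ≤ ε :=
      triLRCrossingProb_charLength_le
        (charLength_set_nonempty Nolin2008_subcritical_crossing_holds hε hq)
    exact Nat.sInf_le (show charLength ε q ∈ {n : ℕ | triLRCrossingProb (min q (σ q)) n n ≤ ε'}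
      from hmem.trans hεε')
  rcases lt_or_gt_of_ne hp with hlt | hgt
  · exact key p hlt
  · rw [← charLength_symm ε' p, ← charLength_symm ε p]
    exact key (σ p) (by rw [unitInterval.coe_symm_eq]; linarith)

/-! ### The upper half `θ(p) ≤ C π₁(L_ε(p))` for every `ε` -/

/-- **Upper half of `θ(p) ≍ π₁(L_ε(p))`, for every `ε > 0`, from the small-`ε` one-arm
stability** (Nolin 2008, §7.4, eq. (7.25), upper inequalities: `θ(p) ≤ P_p(0 ⇝ ∂S_{L(p)})`
"clear", and `P_p(0 ⇝ ∂S_{L(p)}) ≤ C π₁(L(p))` by Thm. 27; Werner 2009, Lecture 6, §1 and §5).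
Given `Werner2009_oneArm_nearCritical` (stability for `N ≤ L(p, ε₀)`, all `ε₀` below a threshold
`ε₁`), for every `ε > 0` there are `δ > 0` and `C` with `θ(p) ≤ C · π₁(L_ε(p))` for
`1/2 < p < 1/2 + δ`: apply the stability at `ε₀ = min ε (ε₁/2)` and `N = L_ε(p)`, admissible
because `L_ε(p) ≤ L_{ε₀}(p) ≤ L(p, ε₀)` (`charLength_anti`, `charLength_le_charLengthW`). [cite: Nolin2008, §7.4, eq. (7.25) (arXiv 0711.4948: display after Cor. 39)] [cite: WernerPCMI2009, Lecture 6, §5 ("It follows that P_p(0 ↔ ∂Λ_n) ≍ P_{1/2}(0 ↔ ∂Λ_n) for n ≤ L(p)")] -/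
theorem triTheta_le_of_oneArm_nearCritical (h1 : Werner2009_oneArm_nearCritical) {ε : ℝ}
    (hε : 0 < ε) :
    ∃ δ > (0 : ℝ), ∃ C : ℝ, ∀ p : unitInterval, 1 / 2 < (p : ℝ) → (p : ℝ) < 1 / 2 + δ →
      triTheta p ≤ C * critOneArmProb (charLength ε p) := by
  obtain ⟨ε₁, hε₁, h1⟩ := h1
  set ε₀ : ℝ := min ε (ε₁ / 2) with hε₀def
  have hε₀ : 0 < ε₀ := lt_min hε (half_pos hε₁)
  have hε₀₁ : ε₀ < ε₁ := (min_le_right _ _).trans_lt (half_lt_self hε₁)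
  have hε₀ε : ε₀ ≤ ε := min_le_left _ _
  obtain ⟨δ, hδ, c, -, C, hb⟩ := h1 hε₀ hε₀₁
  refine ⟨δ, hδ, C, fun p hp hpδ => ?_⟩
  have hN : charLength ε p ≤ charLengthW ε₀ p :=
    (charLength_anti_aux hε₀ hε₀ε hp.ne').trans (charLength_le_charLengthW hε₀ hp.ne')
  calc triTheta p ≤ (triSitePercolation p).real (triOneArm (charLength ε p)) :=
        triTheta_le_real_triOneArm p _
    _ ≤ C * critOneArmProb (charLength ε p) := (hb p hp hpδ _ hN).2

/-! ### The lower half propagates downwards in `ε` -/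

/-- **The lower half of `θ(p) ≍ π₁(L_ε(p))` propagates from `ε'` to every `ε ≤ ε'`**: if
`c · π₁(L_{ε'}(p)) ≤ θ(p)` on a right neighbourhood of `1/2`, then the same holds with `L_ε` for
`0 < ε ≤ ε' < 1/2` (same `c`, smaller neighbourhood), because `1 ≤ L_{ε'}(p) ≤ L_ε(p)` for
`1/2 < p < 1 - ε'` (`one_le_charLength`, `charLength_anti`) and `π₁` is non-increasing
(`triOneArm_anti`). So the lower half matters only for `ε'` close to `1/2` (Nolin 2008, §7.4,
Cor. 41 for every fixed `ε`, through Lemma 39 and the equivalence of lengths Cor. 37). [cite: Nolin2008, §7.4, Cor. 41 with §7.3, Cor. 37 (arXiv 0711.4948: Cor. 39, Cor. 35)] -/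
theorem le_triTheta_anti {ε ε' : ℝ} (hε : 0 < ε) (hεε' : ε ≤ ε') (hε' : ε' < 1 / 2)
    (h : ∃ δ > (0 : ℝ), ∃ c > (0 : ℝ), ∀ p : unitInterval, 1 / 2 < (p : ℝ) → (p : ℝ) < 1 / 2 + δ →
      c * critOneArmProb (charLength ε' p) ≤ triTheta p) :
    ∃ δ > (0 : ℝ), ∃ c > (0 : ℝ), ∀ p : unitInterval, 1 / 2 < (p : ℝ) → (p : ℝ) < 1 / 2 + δ →
      c * critOneArmProb (charLength ε p) ≤ triTheta p := by
  obtain ⟨δ, hδ, c, hc, hb⟩ := h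
  refine ⟨min δ (1 / 2 - ε'), lt_min hδ (by linarith), c, hc, fun p hp hpδ => ?_⟩
  have hpδ' : (p : ℝ) < 1 / 2 + δ := hpδ.trans_le (by linarith [min_le_left δ (1 / 2 - ε')])
  have hp1 : (p : ℝ) < 1 - ε' := by linarith [min_le_right δ (1 / 2 - ε')]
  -- `1 ≤ L_{ε'}(p) = L_{ε'}(1 - p)`, as `ε' < 1 - p < 1/2`
  have hσ : ((σ p : unitInterval) : ℝ) = 1 - p := unitInterval.coe_symm_eq p
  have hL1 : 1 ≤ charLength ε' p := by
    rw [← charLength_symm]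
    exact one_le_charLength Nolin2008_subcritical_crossing_holds (hε.trans_le hεε')
      (by rw [hσ]; linarith) (by rw [hσ]; linarith)
  have hLL : charLength ε' p ≤ charLength ε p := charLength_anti_aux hε hεε' hp.ne'
  have hπ : critOneArmProb (charLength ε p) ≤ critOneArmProb (charLength ε' p) :=
    measureReal_mono (triOneArm_anti hL1 hLL) (measure_ne_top _ _)
  calc c * critOneArmProb (charLength ε p) ≤ c * critOneArmProb (charLength ε' p) :=
        mul_le_mul_of_nonneg_left hπ hc.le
    _ ≤ triTheta p := hb p hp hpδ'

/-! ### `Nolin2008_theta_asymp` from the small-`ε` one-arm stability and Cor. 41 -/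

/-- **`θ(p) ≍ π₁(L_ε(p))` for every `ε ∈ (0, 1/2)`** (the named fact `Nolin2008_theta_asymp`;
Nolin 2008, §7.4, eq. (7.25)) **from `Werner2009_oneArm_nearCritical` and `Nolin2008_cor41`.**
Upper half: `triTheta_le_of_oneArm_nearCritical`; lower half: Cor. 41 at `ε` and the monotonicity
in `p` of the one-arm probability (`critOneArmProb_le_real_triOneArm`), as in the tree's
`Nolin2008_theta_asymp_of_nearCritical`, whose hypothesis `Nolin2008_thm27_oneArm` is here
weakened to the small-`ε`, Werner-length stability. [cite: Nolin2008, §7.4, eq. (7.25) (arXiv 0711.4948: display after Cor. 39)] [cite: WernerPCMI2009, Lecture 6, "End of the proof of the theorem"] -/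
theorem Nolin2008_theta_asymp_of_oneArm_nearCritical (h1 : Werner2009_oneArm_nearCritical)
    (h41 : Nolin2008_cor41) : Nolin2008_theta_asymp := by
  intro ε hε hε'
  obtain ⟨δ₁, hδ₁, C₁, hb₁⟩ := triTheta_le_of_oneArm_nearCritical h1 hε
  obtain ⟨δ₂, hδ₂, c₂, hc₂, hb₂⟩ := h41 hε hε'
  refine ⟨min δ₁ δ₂, lt_min hδ₁ hδ₂, c₂, hc₂, C₁, fun p hp hpδ => ⟨?_, ?_⟩⟩
  · have hhalf : half ≤ p := Subtype.coe_le_coe.1 (by rw [coe_half]; exact hp.le)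
    calc c₂ * critOneArmProb (charLength ε p)
          ≤ c₂ * (triSitePercolation p).real (triOneArm (charLength ε p)) :=
            mul_le_mul_of_nonneg_left (critOneArmProb_le_real_triOneArm hhalf _) hc₂.le
      _ ≤ triTheta p := hb₂ p hp (hpδ.trans_le (by linarith [min_le_right δ₁ δ₂]))
  · exact hb₁ p hp (hpδ.trans_le (by linarith [min_le_left δ₁ δ₂]))

/-- **`Nolin2008_theta_asymp` from five standard near-critical arm estimates and Cor. 41**:
`Werner2009_oneArm_nearCritical_of_facts` (`ParaPivotalSumBounds.lean`: four-arm
quasi-multiplicativity, a priori four-arm lower bound, the two half-plane two-arm bounds, the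
pivotal lower bound) feeds `Nolin2008_theta_asymp_of_oneArm_nearCritical`. [cite: Nolin2008, §7.4, eq. (7.25) (arXiv 0711.4948: display after Cor. 39)] [cite: WernerPCMI2009, Lecture 6, §5] -/
theorem Nolin2008_theta_asymp_of_facts (hQM : Werner2009_fourArm_quasiMult)
    (hLB : Werner2009_fourArm_lowerBound) (hHP : Nolin2008_halfPlane_twoArm)
    (hHP' : Werner2009_halfPlane_twoArm) (hP : Werner2009_pivotal_lowerBound)
    (h41 : Nolin2008_cor41) : Nolin2008_theta_asymp :=
  Nolin2008_theta_asymp_of_oneArm_nearCritical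
    (Werner2009_oneArm_nearCritical_of_facts hQM hLB hHP hHP' hP) h41

/-- **`Nolin2008_theta_asymp` from five standard near-critical arm estimates and the uniform
exponential decay above `L(p)`** (`Nolin2008_lemma39`, every `ε`): as
`Nolin2008_theta_asymp_of_facts`, with Cor. 41 supplied by the ladder
`Nolin2008_cor41_of_ladder` (`NearCriticalArm.lean`) from RSW at `1/2` (`tri_rsw_half_holds`),
`Nolin2008_lemma39` and the sub-critical decay (`Nolin2008_subcritical_crossing_holds`). [cite: Nolin2008, §7.4, Lemma 39, Cor. 41 and eq. (7.25) (arXiv 0711.4948: Lemma 37, Cor. 39)] -/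
theorem Nolin2008_theta_asymp_of_facts' (hQM : Werner2009_fourArm_quasiMult)
    (hLB : Werner2009_fourArm_lowerBound) (hHP : Nolin2008_halfPlane_twoArm)
    (hHP' : Werner2009_halfPlane_twoArm) (hP : Werner2009_pivotal_lowerBound)
    (h39 : Nolin2008_lemma39) : Nolin2008_theta_asymp :=
  Nolin2008_theta_asymp_of_facts hQM hLB hHP hHP' hP
    (Nolin2008_cor41_of_ladder tri_rsw_half_holds h39 Nolin2008_subcritical_crossing_holds)

end Literature.Probability.Percolation
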